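import Literature.NumberTheory.EllipticCurves.ZpExtensionGaloisTwistLocal
import Literature.NumberTheory.EllipticCurves.KummerSelmerStructure
import Literature.NumberTheory.GaloisCohomology.PairingTateDual
import HarnessLib

/-!
# Change of level `E[p^j](χ_u) ↪ E[p^J](χ_u) ↠ E[p^j](χ_u)` (`j ≤ J`) for the twisted torsion modules,
# its Tate dual, and the compatibility with the maps to `H¹(K_∞, E[p^∞])` (definitions + theorems)

Topic `NumberTheory/EllipticCurves` (next to `ZpExtensionGaloisTwistRestrict`, `ZpExtensionGaloisTwistLocal`);
namespace `WeierstrassCurve`. DEFINITIONS WITH BODIES + theorems; no named fact, no instance, no notation.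

Greenberg (LNM 1716, §4 pp. 123–125) works with the divisible twisted module `A_s = E[p^∞] ⊗ κ^s` and its
Tate module `T^* = T_p(E) ⊗ κ^{−s}`; the cell `bsd-2adic` replaces them by the finite levels
`M_J = E[p^J](χ_u)` (`W.twistedTorsionGaloisModule p κ J u hu`) and exponent bookkeeping between two levels
`j ≤ J` (design memo HOME/t42/DESIGN-T42-ADDENDUM-16.md §A16.8, bricks (N2), (β1), (β2)). This file provides
the three maps this bookkeeping uses and their formal properties:

* `W.twistedTorsionIncl p κ hjJ u hu : E[p^j](χ_u) →ⁱL E[p^J](χ_u)` — the inclusion `ι` (continuous,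
  `Γ_K`-equivariant: the level-`J` exponent `κ σ mod p^J` acts on `p^j`-torsion as the level-`j` exponent,
  `ZpExtension.twistExponent_mod_pow` + `pow_mod_zsmul_eq`);
* `W.twistedTorsionMulPow p κ hjJ u hu : E[p^J](χ_u) →ⁱL E[p^j](χ_u)` — multiplication by `p^{J−j}` (`π`),
  with `ι (π P) = p^{J−j} • P`, `π (ι Q) = p^{J−j} • Q`;
* `W.twistedTorsionInclDual p κ hjJ u hu : E[p^J](χ_u)^D →ⁱL E[p^j](χ_u)^D` — the Tate dual `ι^D` of `ι`
  (restriction of homomorphisms, both duals `Hom(·, μ_{p^J})` at the SAME `n = p^J`; the tree's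
  `pairingDualIntertwining` of the pairing `(Q, f) ↦ f (ι Q)`), with `(ι^D f) Q = f (ι Q)`;
* compatibilities: `twistedTorsionToH1 ∘ H¹(ι) = twistedTorsionToH1` (the maps
  `H¹(Γ_K, E[p^j](χ_u)) → H¹(K_∞, E[p^∞])` of the two levels, file `ZpExtensionGaloisTwistRestrict`) and, at a
  completion `E`, `twistedTorsionToLocalH1 ∘ H¹(ι|_{Γ_E}) = twistedTorsionToLocalH1` — so a local target of level
  `j` pushed to level `J` has the same image in `H¹((K_∞)_w, E)` (the level change (N2) of the memo).

Not here (proofs files): the adjunction `⟨ι_* t, y⟩_v = ⟨t, ι^D_* y⟩_v` of the local Tate pairings, the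
vanishing of `π_*` on classes killed by `p^{J−j}` that are locally trivial at a place with small twisted
invariants, the Weil-pairing identification of `ι^D` with `π`.

References: R. Greenberg, *Iwasawa theory for elliptic curves*, LNM 1716 (1999), §4 pp. 105, 123–125
[GreenbergLNM1716]; J.-P. Serre, *Galois Cohomology* (1997), I §2.2–§2.4 [SerreGaloisCohomology1997];
J. S. Milne, *Arithmetic Duality Theorems* (2006), I §2 (`M^D`) [MilneADT2006].
-/

noncomputable section

open CategoryTheory Field
open scoped ContRepresentation

universe u

namespace WeierstrassCurve

open Literature.NumberTheory.EllipticCurves Literature.NumberTheory.GaloisRepresentations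
open Literature.NumberTheory.GaloisRepresentations.DiscreteGaloisModule (TateDual tateDual tateDualEval
  pairingDualIntertwining)

variable {K : Type u} [Field K] (W : WeierstrassCurve K) (p : ℕ) [Fact p.Prime] (κ : ZpExtension K p)
  {j J : ℕ}

/-! ## `E[p^j] ≤ E[p^J]` and the twisted scalars on `p^j`-torsion -/

omit [Fact p.Prime] in
/-- `E[p^j] ⊆ E[p^J]` for `j ≤ J`. [cite: SilvermanAEC2009, Cor. III.6.4] -/
theorem geomTorsion_pow_le_pow (hjJ : j ≤ J) :
    W.geomTorsion ((p ^ j : ℕ) : ℤ) ≤ W.geomTorsion ((p ^ J : ℕ) : ℤ) := by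
  intro P hP
  have hP' : ((p ^ j : ℕ) : ℤ) • P = 0 := (Submodule.mem_torsionBy_iff _ _).mp hP
  refine (Submodule.mem_torsionBy_iff _ _).mpr ?_
  obtain ⟨k, hk⟩ := Nat.exists_eq_add_of_le hjJ
  rw [hk, pow_add, Nat.cast_mul, mul_comm, mul_smul, hP', smul_zero]

/-- On `E[p^j]` the level-`J` twisted scalar `u^{κ σ mod p^J}` acts as the level-`j` scalar `u^{κ σ mod p^j}`
(`j ≤ J`; `twistExponent_mod_pow` and `pow_mod_zsmul_eq`). [cite: Washington1997, §13.1–§13.2] -/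
theorem pow_twistExponent_zsmul_eq_of_le (hjJ : j ≤ J) {u : ℤ} (hu : (p : ℤ) ∣ u - 1)
    (σ : absoluteGaloisGroup K) (P : W.geomTorsion ((p ^ j : ℕ) : ℤ)) :
    (u ^ κ.twistExponent J σ) • P = (u ^ κ.twistExponent j σ) • P := by
  rw [← κ.twistExponent_mod_pow (J := J) hjJ σ,
    ZpExtension.pow_mod_zsmul_eq (W.pow_nsmul_geomTorsion_pow p j) hu]

variable (hjJ : j ≤ J) (u : ℤ) (hu : (p : ℤ) ∣ u - 1)

/-! ## The inclusion `ι : E[p^j](χ_u) ↪ E[p^J](χ_u)` -/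

/-- **The inclusion `ι : E[p^j](χ_u) →ⁱL E[p^J](χ_u)`** (`j ≤ J`) as a continuous `Γ_K`-intertwining map of the
twisted torsion modules (underlying map `AddSubgroup.inclusion`). Greenberg's `A_s[p^j] ⊆ A_s[p^J]`.
[cite: GreenbergLNM1716, §4 pp. 105, 123] -/
def twistedTorsionIncl :
    (W.twistedTorsionGaloisModule p κ j u hu).toContRepresentation →ⁱL
      (W.twistedTorsionGaloisModule p κ J u hu).toContRepresentation where
  toContinuousLinearMap :=
    ⟨(AddSubgroup.inclusion (W.geomTorsion_pow_le_pow p hjJ)).toIntLinearMap,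
      continuous_of_discreteTopology⟩
  isIntertwining' σ := by
    refine ContinuousLinearMap.ext fun P ↦ ?_
    change AddSubgroup.inclusion (W.geomTorsion_pow_le_pow p hjJ)
        (W.twistedTorsionGaloisModule p κ j u hu σ P) =
      W.twistedTorsionGaloisModule p κ J u hu σ
        (AddSubgroup.inclusion (W.geomTorsion_pow_le_pow p hjJ) P)
    rw [ZpExtension.galoisTwist_apply_apply, ZpExtension.galoisTwist_apply_apply,
      torsionGaloisModule_apply_apply, torsionGaloisModule_apply_apply,
      ← W.pow_twistExponent_zsmul_eq_of_le p κ hjJ hu σ (σ • P), map_zsmul]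
    rfl

/-- Unfolding `ι` on points of `E(K̄)`: `(ι P : E(K̄)) = P`. [cite: GreenbergLNM1716, §4 p. 105] -/
@[simp] theorem coe_twistedTorsionIncl_apply (P : W.geomTorsion ((p ^ j : ℕ) : ℤ)) :
    ((W.twistedTorsionIncl p κ hjJ u hu P : W.geomTorsion ((p ^ J : ℕ) : ℤ)) : W.geomPoints) = P := rfl

/-- `ι` is the inclusion of subgroups. [cite: GreenbergLNM1716, §4 p. 105] -/
theorem twistedTorsionIncl_apply (P : W.geomTorsion ((p ^ j : ℕ) : ℤ)) :
    W.twistedTorsionIncl p κ hjJ u hu P = AddSubgroup.inclusion (W.geomTorsion_pow_le_pow p hjJ) P := rfl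

/-- `ι` is injective. [cite: GreenbergLNM1716, §4 p. 105] -/
theorem twistedTorsionIncl_injective : Function.Injective (W.twistedTorsionIncl p κ hjJ u hu) :=
  fun _ _ h ↦ AddSubgroup.inclusion_injective (W.geomTorsion_pow_le_pow p hjJ) h

/-! ## Multiplication by `p^{J-j}`: `π : E[p^J](χ_u) ↠ E[p^j](χ_u)` -/

omit [Fact p.Prime] in
/-- `p^J ∣ p^j · p^{J−j}` (the divisibility making `p^{J−j} · E[p^J] ⊆ E[p^j]`). [cite: SilvermanAEC2009, Cor. III.6.4] -/
theorem pow_dvd_pow_mul_pow_sub (hjJ : j ≤ J) :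
    ((p ^ J : ℕ) : ℤ) ∣ ((p ^ j : ℕ) : ℤ) * ((p ^ (J - j) : ℕ) : ℤ) := by
  rw [← Nat.cast_mul, ← pow_add, Nat.add_sub_cancel' hjJ]

/-- **Multiplication by `p^{J−j}`, `π : E[p^J](χ_u) →ⁱL E[p^j](χ_u)`** (`j ≤ J`), as a continuous
`Γ_K`-intertwining map of the twisted torsion modules (underlying map the tree's `geomTorsionZSMul`).
[cite: GreenbergLNM1716, §4 pp. 123–125] -/
def twistedTorsionMulPow :
    (W.twistedTorsionGaloisModule p κ J u hu).toContRepresentation →ⁱL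
      (W.twistedTorsionGaloisModule p κ j u hu).toContRepresentation where
  toContinuousLinearMap :=
    ⟨(W.geomTorsionZSMul ((p ^ (J - j) : ℕ) : ℤ) (pow_dvd_pow_mul_pow_sub p hjJ)).toIntLinearMap,
      continuous_of_discreteTopology⟩
  isIntertwining' σ := by
    refine ContinuousLinearMap.ext fun P ↦ ?_
    change W.geomTorsionZSMul ((p ^ (J - j) : ℕ) : ℤ) (pow_dvd_pow_mul_pow_sub p hjJ)
        (W.twistedTorsionGaloisModule p κ J u hu σ P) =
      W.twistedTorsionGaloisModule p κ j u hu σ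
        (W.geomTorsionZSMul ((p ^ (J - j) : ℕ) : ℤ) (pow_dvd_pow_mul_pow_sub p hjJ) P)
    rw [ZpExtension.galoisTwist_apply_apply, ZpExtension.galoisTwist_apply_apply,
      torsionGaloisModule_apply_apply, torsionGaloisModule_apply_apply, map_zsmul,
      W.geomTorsionZSMul_smul]
    exact W.pow_twistExponent_zsmul_eq_of_le p κ hjJ hu σ _

/-- Unfolding `π` on points of `E(K̄)`: `(π P : E(K̄)) = p^{J−j} • P`. [cite: GreenbergLNM1716, §4 p. 123] -/
@[simp] theorem coe_twistedTorsionMulPow_apply (P : W.geomTorsion ((p ^ J : ℕ) : ℤ)) :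
    ((W.twistedTorsionMulPow p κ hjJ u hu P : W.geomTorsion ((p ^ j : ℕ) : ℤ)) : W.geomPoints) =
      ((p ^ (J - j) : ℕ) : ℤ) • (P : W.geomPoints) := rfl

/-- `ι (π P) = p^{J−j} • P` in `E[p^J]`. [cite: GreenbergLNM1716, §4 p. 123] -/
theorem twistedTorsionIncl_mulPow (P : W.geomTorsion ((p ^ J : ℕ) : ℤ)) :
    W.twistedTorsionIncl p κ hjJ u hu (W.twistedTorsionMulPow p κ hjJ u hu P) =
      ((p ^ (J - j) : ℕ) : ℤ) • P :=
  Subtype.ext rfl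

/-- `π (ι Q) = p^{J−j} • Q` in `E[p^j]`. [cite: GreenbergLNM1716, §4 p. 123] -/
theorem twistedTorsionMulPow_incl (Q : W.geomTorsion ((p ^ j : ℕ) : ℤ)) :
    W.twistedTorsionMulPow p κ hjJ u hu (W.twistedTorsionIncl p κ hjJ u hu Q) =
      ((p ^ (J - j) : ℕ) : ℤ) • Q :=
  Subtype.ext rfl

/-- The kernel of `π` is `E[p^{J−j}]`: `π P = 0 ↔ p^{J−j} • P = 0`. [cite: GreenbergLNM1716, §4 p. 123] -/
theorem twistedTorsionMulPow_apply_eq_zero_iff (P : W.geomTorsion ((p ^ J : ℕ) : ℤ)) :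
    W.twistedTorsionMulPow p κ hjJ u hu P = 0 ↔ ((p ^ (J - j) : ℕ) : ℤ) • P = 0 := by
  rw [← (W.twistedTorsionIncl_injective p κ hjJ u hu).eq_iff, twistedTorsionIncl_mulPow, map_zero]

/-- A point of `E[p^J]` killed by `p^j` is in the image of `ι`. [cite: SilvermanAEC2009, Cor. III.6.4] -/
theorem exists_twistedTorsionIncl_eq_of_smul_eq_zero (P : W.geomTorsion ((p ^ J : ℕ) : ℤ))
    (hP : ((p ^ j : ℕ) : ℤ) • P = 0) :
    ∃ Q : W.geomTorsion ((p ^ j : ℕ) : ℤ), W.twistedTorsionIncl p κ hjJ u hu Q = P := by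
  refine ⟨⟨(P : W.geomPoints), (Submodule.mem_torsionBy_iff _ _).mpr ?_⟩, Subtype.ext rfl⟩
  have h := congrArg (fun R : W.geomTorsion ((p ^ J : ℕ) : ℤ) ↦ (R : W.geomPoints)) hP
  simp only [AddSubgroupClass.coe_zsmul, ZeroMemClass.coe_zero] at h
  exact h

/-! ## The Tate dual `ι^D : E[p^J](χ_u)^D → E[p^j](χ_u)^D` -/

section Dual

/-! Both Tate duals need `E[p^j]`, `E[p^J]` finite (true for an elliptic curve, Silverman *AEC* III.6.4, tree
`finite_torsionPoints_holds` / `finite_geomTorsion_of_neZero`; supplied by the consumer as instances — no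
instance is declared in this definitions file). -/
variable [Finite (W.geomTorsion ((p ^ j : ℕ) : ℤ))] [Finite (W.geomTorsion ((p ^ J : ℕ) : ℤ))]


omit [Finite (W.geomTorsion ((p ^ j : ℕ) : ℤ))] in
/-- The pairing `E[p^j](χ_u) × E[p^J](χ_u)^D → μ_{p^J}`, `(Q, f) ↦ f (ι Q)`, is `Γ_K`-equivariant (evaluation
pairing `tateDualEval_smul` and the equivariance of `ι`). [cite: MilneADT2006, Ch. I §2] -/
theorem tateDualEval_comp_twistedTorsionIncl_smul (σ : absoluteGaloisGroup K)
    (Q : W.geomTorsion ((p ^ j : ℕ) : ℤ))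
    (f : TateDual K (W.geomTorsion ((p ^ J : ℕ) : ℤ)) (p ^ J)) :
    ((tateDualEval K (W.geomTorsion ((p ^ J : ℕ) : ℤ)) (p ^ J)).comp
        (W.twistedTorsionIncl p κ hjJ u hu).toLinearMap.toAddMonoidHom)
        (W.twistedTorsionGaloisModule p κ j u hu σ Q)
        ((W.twistedTorsionGaloisModule p κ J u hu).tateDual (p ^ J) σ f) =
      DiscreteGaloisModule.mu K (p ^ J) σ
        ((tateDualEval K (W.geomTorsion ((p ^ J : ℕ) : ℤ)) (p ^ J)).comp
          (W.twistedTorsionIncl p κ hjJ u hu).toLinearMap.toAddMonoidHom Q f) := by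
  rw [AddMonoidHom.comp_apply, AddMonoidHom.comp_apply]
  have hι : (W.twistedTorsionIncl p κ hjJ u hu).toLinearMap.toAddMonoidHom
      (W.twistedTorsionGaloisModule p κ j u hu σ Q) =
      W.twistedTorsionGaloisModule p κ J u hu σ
        ((W.twistedTorsionIncl p κ hjJ u hu).toLinearMap.toAddMonoidHom Q) := by
    have h := (W.twistedTorsionIncl p κ hjJ u hu).isIntertwining' σ
    exact congrArg (fun T ↦ T Q) h
  rw [hι]
  exact DiscreteGaloisModule.tateDualEval_smul _ _ σ _ f

/-- **The Tate dual `ι^D : E[p^J](χ_u)^D →ⁱL E[p^j](χ_u)^D` of the inclusion** — restriction of homomorphisms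
`Hom(E[p^J], μ_{p^J}) → Hom(E[p^j], μ_{p^J})`, both Tate duals taken at the same `n = p^J`; the tree's
`pairingDualIntertwining` of the pairing `(Q, f) ↦ f (ι Q)`. [cite: MilneADT2006, Ch. I §2] -/
def twistedTorsionInclDual :
    ((W.twistedTorsionGaloisModule p κ J u hu).tateDual (p ^ J)).toContRepresentation →ⁱL
      ((W.twistedTorsionGaloisModule p κ j u hu).tateDual (p ^ J)).toContRepresentation :=
  pairingDualIntertwining (ρ₁ := W.twistedTorsionGaloisModule p κ j u hu)
    (ρ₂ := (W.twistedTorsionGaloisModule p κ J u hu).tateDual (p ^ J)) (n := p ^ J)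
    (B := (tateDualEval K (W.geomTorsion ((p ^ J : ℕ) : ℤ)) (p ^ J)).comp
      (W.twistedTorsionIncl p κ hjJ u hu).toLinearMap.toAddMonoidHom)
    (W.tateDualEval_comp_twistedTorsionIncl_smul p κ hjJ u hu)

/-- Unfolding `ι^D`: `(ι^D f) Q = f (ι Q)`. [cite: MilneADT2006, Ch. I §2] -/
@[simp] theorem twistedTorsionInclDual_apply_apply
    (f : TateDual K (W.geomTorsion ((p ^ J : ℕ) : ℤ)) (p ^ J)) (Q : W.geomTorsion ((p ^ j : ℕ) : ℤ)) :
    W.twistedTorsionInclDual p κ hjJ u hu f Q = f (W.twistedTorsionIncl p κ hjJ u hu Q) := rfl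

end Dual

/-! ## Compatibility with the maps to `H¹(K_∞, E[p^∞])` and to `H¹((K_∞)_w, E)` -/

/-- **`twistedTorsionToH1 ∘ H¹(ι) = twistedTorsionToH1`**: pushing a class of `H¹(Γ_K, E[p^j](χ_u))` to level `J`
and then to `H¹(K_∞, E[p^∞])` is pushing it directly (both are the class of `h ↦ ξ(h)` read in `E[p^∞]`).
[cite: GreenbergLNM1716, §4 p. 124] [cite: SerreGaloisCohomology1997, I §2.2] -/
theorem twistedTorsionToH1_map_incl
    (x : galoisCohomology (W.twistedTorsionGaloisModule p κ j u hu) 1) :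
    W.twistedTorsionToH1 p κ J u hu (galoisCohomology.map (W.twistedTorsionIncl p κ hjJ u hu) 1 x) =
      W.twistedTorsionToH1 p κ j u hu x := by
  obtain ⟨ξ, rfl⟩ := oneCocycleClass_surjective _ x
  rw [galoisCohomology.map_one_oneCocycleClass, twistedTorsionToH1_oneCocycleClass,
    twistedTorsionToH1_oneCocycleClass]
  exact congrArg _ (Subtype.ext (ContinuousMap.ext fun _ ↦ rfl))

/-- **`twistedTorsionToLocalH1 ∘ H¹(ι|_{Γ_E}) = twistedTorsionToLocalH1`** at a completion `E` (any `K`-algebra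
field): a local target of level `j` pushed to level `J` has the same image in `H¹((K_∞)_w, E)`.
[cite: GreenbergLNM1716, §4 p. 124] [cite: SerreGaloisCohomology1997, I §2.4] -/
theorem twistedTorsionToLocalH1_map_incl (E : Type u) [Field E] [Algebra K E]
    (t : galoisCohomology ((W.twistedTorsionGaloisModule p κ j u hu).restrictField E) 1) :
    W.twistedTorsionToLocalH1 p κ J u hu E
        (galoisCohomology.map ((W.twistedTorsionIncl p κ hjJ u hu).restrictField E) 1 t) =
      W.twistedTorsionToLocalH1 p κ j u hu E t := by
  obtain ⟨ξ, rfl⟩ := oneCocycleClass_surjective _ t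
  rw [galoisCohomology.map_one_oneCocycleClass, twistedTorsionToLocalH1_oneCocycleClass,
    twistedTorsionToLocalH1_oneCocycleClass]
  exact congrArg _ (Subtype.ext (ContinuousMap.ext fun _ ↦ rfl))

/-- Localisation commutes with `H¹(ι)`: `loc_E (H¹(ι) x) = H¹(ι|_{Γ_E}) (loc_E x)` (the tree's `res_map_one`).
[cite: SerreGaloisCohomology1997, I §2.4] -/
theorem res_map_twistedTorsionIncl (E : Type u) [Field E] [Algebra K E]
    (x : galoisCohomology (W.twistedTorsionGaloisModule p κ j u hu) 1) :
    galoisCohomology.res (W.twistedTorsionGaloisModule p κ J u hu) E 1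
        (galoisCohomology.map (W.twistedTorsionIncl p κ hjJ u hu) 1 x) =
      galoisCohomology.map ((W.twistedTorsionIncl p κ hjJ u hu).restrictField E) 1
        (galoisCohomology.res (W.twistedTorsionGaloisModule p κ j u hu) E 1 x) :=
  galoisCohomology.res_map_one E _ x

end WeierstrassCurve

end
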